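import Literature.MathematicalPhysics.KineticTheory.HardSphereEuler
import Literature.Analysis.FunctionSpaces.TorusMollifier
import Literature.Analysis.FunctionSpaces.TorusCalculusProofs
import Literature.Analysis.FunctionSpaces.TorusSpaceTime
import Literature.Analysis.FluidPDE.HardSphereTorusMeasure
import HarnessLib

/-!
# The hyperbolic zoom of compactly supported bubbles on `𝕋³`, I: the zoom map and its calculus

Helper file for the stub `stub_bubble : BubbleAtScale` of the line `Sketch` of the crux
`ConeLocalisation` (stmt-AtomisticToContinuum-12504, route `RelayRaceLocality`).

The compressible Euler system is invariant under `(t, x) ↦ (t/m, x₀ + (x - x₀)/m)`. On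
`𝕋³ = ℝ³/ℤ³` the dilation makes sense only chart-wise; it is realised through the centred
representative `Torus.reprc : 𝕋³ → [-1/2, 1/2)³` (`TorusMollifier.lean`):
`zoomPt x₀ m y := x₀ + proj (m⁻¹ • reprc (y - x₀))`. For `m > 1` this contracts the torus, cut
open along the cube antipodal to `x₀`, by `m⁻¹` towards `x₀`: a radial similarity for the
minimal-image distance (`euclidDist_zoomPt`, **(Z3)**) onto the cube of half-width `1/(2m)`
(`zoomPt_unzoom`, the inverse-point formula).

LOCAL STRUCTURE (`zoomPt_local`): near every `y`, in the chart `v ↦ y + proj v`, either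
`zoomPt (y + proj v) = zoomPt y + proj (m⁻¹ • v)`, or all nearby points go to distance `≥ 1/(4m)`
from `x₀`. Hence for ANY field `F` on `𝕋³` constant outside `{d(·, x₀) < a}` with `m a < 1/4`,
the zoomed field `F ∘ zoomPt x₀ m` is chart-wise either `F` precomposed with `v ↦ m⁻¹ v` or
constant: the torus partial derivatives obey the chain rule with JUNK VALUES INCLUDED
(`partialDeriv_zoom`, **(Z2)**; `partialDeriv_eq_zero_of_far` feeds the iteration), and (joint
space–time) smoothness is preserved (`isSmoothSpaceTimeOn_zoom`, `isSmooth_zoom`). Iterated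
words, `∇`, `div`, `∂ₜ` under `s ↦ s/m` and the covariance of `IsHardSphereEulerSolution`
(**(Z1)**) are in the sibling file `RelayRaceLocalityConeLocalisationBubbleZoomB.lean`.

References: R. Courant, K. O. Friedrichs, *Supersonic Flow and Shock Waves* (1948), §17
(similarity of gas flows); L. Grafakos, *Classical Fourier Analysis* (3rd ed. 2014), §3.1.1
(the fundamental cube `[-1/2,1/2)ⁿ` of `𝕋ⁿ`).
-/

noncomputable section

open scoped Topology Pointwise ContDiff
open Filter Set Metric
open Literature.MathematicalPhysics.KineticTheory Literature.Analysis.FluidPDE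
  Literature.Analysis.FunctionSpaces

namespace Summit.AtomisticToContinuum.HydrodynamicLimit.Theorems.ConeLocalisation.Bubble

/-! ## The zoom map -/

/-- The **hyperbolic zoom map** of factor `m` centred at `x₀ ∈ 𝕋³`:
`y ↦ x₀ + proj (m⁻¹ • reprc (y - x₀))`, the contraction by `m⁻¹` towards `x₀` of the torus cut
open along the cube antipodal to `x₀` (`reprc` = representative in `[-1/2,1/2)³`). [folklore] -/
def zoomPt (x₀ : T3) (m : ℝ) (y : T3) : T3 :=
  x₀ + Torus.proj (m⁻¹ • Torus.reprc (y - x₀))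

/-! ## Minimal-image geometry of the zoom -/

/-- The coordinates of the centred representative realise the circle norms: `|reprc z i| = ‖z i‖`. -/
theorem abs_reprc_apply (z : T3) (i : Fin 3) : |Torus.reprc z i| = ‖z i‖ := by
  have h1 : ‖((Torus.reprc z i : ℝ) : UnitAddCircle)‖ = |Torus.reprc z i| :=
    (AddCircle.norm_coe_eq_abs_iff (1 : ℝ) one_ne_zero).2
      (by simpa using Torus.abs_reprc_apply_le z i)
  have h2 : z i = ((Torus.reprc z i : ℝ) : UnitAddCircle) := by
    conv_lhs => rw [← Torus.proj_reprc z]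
    rfl
  rw [← h1, ← h2]

/-- **The missing bridge**: the Euclidean norm of the centred representative is the minimal-image
distance to the origin, `‖reprc z‖ = d(z, 0)` (both are `(∑ᵢ ‖zᵢ‖²)^{1/2}`). -/
theorem norm_reprc_eq_euclidDist (z : T3) : ‖Torus.reprc z‖ = Torus.euclidDist z 0 := by
  rw [Torus.euclidDist_eq, sub_zero, EuclideanSpace.norm_eq, EuclideanSpace.norm_eq]
  congr 1
  refine Finset.sum_congr rfl fun i _ => ?_
  rw [Real.norm_eq_abs, Real.norm_eq_abs, abs_reprc_apply, Torus.abs_reprSym_apply]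

/-- `‖reprc (y - x₀)‖ = d(y, x₀)`. -/
theorem norm_reprc_sub_eq_euclidDist (y x₀ : T3) :
    ‖Torus.reprc (y - x₀)‖ = Torus.euclidDist y x₀ := by
  rw [norm_reprc_eq_euclidDist, Torus.euclidDist_eq, Torus.euclidDist_eq, sub_zero]

/-- In the open cube `(-1/2, 1/2)³` the symmetric representative of `proj q` is `q`. -/
theorem reprSym_proj_of_abs_lt {q : V3} (hq : ∀ i, |q i| < 1 / 2) :
    Torus.reprSym (Torus.proj q) = q := by
  have h := Torus.reprSym_add_proj (x := (0 : T3)) (s := q) (fun i => by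
    have := abs_lt.1 (hq i)
    simp only [Torus.reprSym_zero, PiLp.zero_apply, zero_add, mem_Ioc]
    exact ⟨this.1, this.2.le⟩)
  rwa [zero_add, Torus.reprSym_zero, zero_add] at h

/-- In the open cube the chart `q ↦ x₀ + proj q` is a radial isometry: `d(x₀ + proj q, x₀) = ‖q‖`. -/
theorem euclidDist_add_proj_of_abs_lt (x₀ : T3) {q : V3} (hq : ∀ i, |q i| < 1 / 2) :
    Torus.euclidDist (x₀ + Torus.proj q) x₀ = ‖q‖ := by
  rw [Torus.euclidDist_eq, add_sub_cancel_left, reprSym_proj_of_abs_lt hq]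

/-- For `m > 1` the contracted representative `m⁻¹ • reprc z` lies in the open cube. -/
theorem abs_inv_smul_reprc_apply_lt {m : ℝ} (hm : 1 < m) (z : T3) (i : Fin 3) :
    |(m⁻¹ • Torus.reprc z) i| < 1 / 2 := by
  have h0 : 0 < m⁻¹ := inv_pos.2 (zero_lt_one.trans hm)
  have h1 : m⁻¹ < 1 := inv_lt_one_of_one_lt₀ hm
  rw [PiLp.smul_apply, smul_eq_mul, abs_mul, abs_of_pos h0]
  have h2 := Torus.abs_reprc_apply_le z i
  nlinarith

/-- **(Z3) The zoom is a radial similarity of ratio `m⁻¹`**: `d(zoomPt x₀ m y, x₀) = m⁻¹ d(y, x₀)`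
for `m > 1`. -/
theorem euclidDist_zoomPt {m : ℝ} (hm : 1 < m) (x₀ y : T3) :
    Torus.euclidDist (zoomPt x₀ m y) x₀ = m⁻¹ * Torus.euclidDist y x₀ := by
  rw [zoomPt, euclidDist_add_proj_of_abs_lt x₀ (abs_inv_smul_reprc_apply_lt hm _), norm_smul,
    Real.norm_eq_abs, abs_of_pos (inv_pos.2 (zero_lt_one.trans hm)), norm_reprc_sub_eq_euclidDist]

/-- A field constant outside `{d(·, x₀) < a}` is, after zooming, constant outside
`{d(·, x₀) < m a}` (**(Z2)**, support clause). -/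
theorem zoom_eq_of_le {X : Type*} {m a : ℝ} (hm : 1 < m) {x₀ : T3} {F : T3 → X} {c : X}
    (hF : ∀ x, a ≤ Torus.euclidDist x x₀ → F x = c) {y : T3}
    (hy : m * a ≤ Torus.euclidDist y x₀) : F (zoomPt x₀ m y) = c := by
  refine hF _ ?_
  rw [euclidDist_zoomPt hm, le_inv_mul_iff₀ (zero_lt_one.trans hm)]
  exact hy

/-- **Inverse-point formula**: for `d(x, x₀) < 1/(2m)` the point `x₀ + proj (m • reprc (x - x₀))`
is zoomed onto `x` (the zoom is onto the cube of half-width `1/(2m)` around `x₀`). -/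
theorem zoomPt_unzoom {m : ℝ} (hm : 0 < m) {x₀ x : T3}
    (hx : Torus.euclidDist x x₀ < 1 / (2 * m)) :
    zoomPt x₀ m (x₀ + Torus.proj (m • Torus.reprc (x - x₀))) = x := by
  have hn : ‖m • Torus.reprc (x - x₀)‖ < 1 / 2 := by
    rw [norm_smul, Real.norm_eq_abs, abs_of_pos hm, norm_reprc_sub_eq_euclidDist]
    rw [lt_div_iff₀ (by positivity)] at hx
    linarith
  rw [zoomPt, add_sub_cancel_left, Torus.reprc_proj_of_norm_lt hn, smul_smul,
    inv_mul_cancel₀ hm.ne', one_smul, Torus.proj_reprc, add_sub_cancel]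

/-- The inverse point dilates distances: `d(x₀ + proj (m • reprc (x - x₀)), x₀) = m d(x, x₀)` for
`d(x, x₀) < 1/(2m)`. -/
theorem euclidDist_unzoom {m : ℝ} (hm : 0 < m) {x₀ x : T3}
    (hx : Torus.euclidDist x x₀ < 1 / (2 * m)) :
    Torus.euclidDist (x₀ + Torus.proj (m • Torus.reprc (x - x₀))) x₀ = m * Torus.euclidDist x x₀ := by
  have hn : ‖m • Torus.reprc (x - x₀)‖ < 1 / 2 := by
    rw [norm_smul, Real.norm_eq_abs, abs_of_pos hm, norm_reprc_sub_eq_euclidDist]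
    rw [lt_div_iff₀ (by positivity)] at hx
    linarith
  rw [euclidDist_add_proj_of_abs_lt x₀ fun i => (Torus.abs_apply_le_norm _ i).trans_lt hn,
    norm_smul, Real.norm_eq_abs, abs_of_pos hm, norm_reprc_sub_eq_euclidDist]

/-! ## Local structure of the zoom: chart case and far case -/

/-- `y + proj v - x₀ = proj (reprc (y - x₀) + v)`. -/
theorem add_proj_sub_eq (x₀ y : T3) (v : V3) :
    y + Torus.proj v - x₀ = Torus.proj (Torus.reprc (y - x₀) + v) := by
  rw [Torus.proj_add, Torus.proj_reprc]; abel

/-- **Chart case.** If the centred representative of `y - x₀` has norm `< 3/8` (away from the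
cut locus), then in the chart `v ↦ y + proj v`, `‖v‖ < 1/8`, the zoom IS the affine contraction
`zoomPt (y + proj v) = zoomPt y + proj (m⁻¹ • v)`. -/
theorem zoomPt_add_proj_of_near (x₀ : T3) (m : ℝ) {y : T3} {v : V3}
    (h : ‖Torus.reprc (y - x₀)‖ < 3 / 8) (hv : ‖v‖ < 1 / 8) :
    zoomPt x₀ m (y + Torus.proj v) = zoomPt x₀ m y + Torus.proj (m⁻¹ • v) := by
  have hn : ‖Torus.reprc (y - x₀) + v‖ < 1 / 2 := (norm_add_le _ _).trans_lt (by linarith)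
  rw [zoomPt, zoomPt, add_proj_sub_eq, Torus.reprc_proj_of_norm_lt hn, smul_add, Torus.proj_add,
    add_assoc]

/-- **Far case.** If the centred representative of `y - x₀` has norm `≥ 3/8`, then for `‖v‖ < 1/8`
the centred representative of `y + proj v - x₀` keeps norm `≥ 1/4`: it differs from
`reprc (y - x₀) + v` by an integer vector, either zero (triangle inequality) or with a coordinate
of modulus `≥ 1`, forcing a coordinate of modulus `≥ 3/8` (cf. `Torus.transplant_proj_eventuallyEq`). -/
theorem norm_reprc_ge_of_far (x₀ : T3) {y : T3} {v : V3}
    (h : 3 / 8 ≤ ‖Torus.reprc (y - x₀)‖) (hv : ‖v‖ < 1 / 8) :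
    1 / 4 ≤ ‖Torus.reprc (y + Torus.proj v - x₀)‖ := by
  set r₀ := Torus.reprc (y - x₀) with hr₀
  set r := Torus.reprc (y + Torus.proj v - x₀) with hr
  have hproj : Torus.proj r = Torus.proj (r₀ + v) := by
    rw [hr, Torus.proj_reprc, add_proj_sub_eq]
  by_cases heq : r = r₀ + v
  · rw [heq]
    have h1 : ‖r₀‖ ≤ ‖r₀ + v‖ + ‖v‖ := by
      have := norm_add_le (r₀ + v) (-v)
      rwa [add_neg_cancel_right, norm_neg] at this
    linarith
  · have hne : ∃ i, r i ≠ (r₀ + v) i := by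
      by_contra hall
      push Not at hall
      exact heq (PiLp.ext hall)
    obtain ⟨i, hi⟩ := hne
    obtain ⟨n, hn⟩ := Torus.exists_int_eq_sub_of_proj_eq hproj i
    have hn0 : n ≠ 0 := by
      rintro rfl
      exact hi (by simpa [sub_eq_zero] using hn.symm)
    have hn1 : (1 : ℝ) ≤ |(n : ℝ)| := by
      rw [← Int.cast_abs]; exact_mod_cast Int.one_le_abs hn0
    have h1 : |r₀ i| ≤ 1 / 2 := Torus.abs_reprc_apply_le _ i
    have h2 : |v i| < 1 / 8 := (Torus.abs_apply_le_norm v i).trans_lt hv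
    have h3 : |r i| ≤ ‖r‖ := Torus.abs_apply_le_norm r i
    rw [PiLp.add_apply] at hn
    have h4 : |(n : ℝ)| ≤ |r i| + |r₀ i| + |v i| := by
      rw [hn]
      exact (abs_sub _ _).trans (by linarith [abs_add_le (r₀ i) (v i)])
    linarith

/-- **Local structure of the zoom (`m > 1`).** Near every `y ∈ 𝕋³`, in the chart `v ↦ y + proj v`,
`‖v‖ < 1/8`: EITHER `zoomPt (y + proj v) = zoomPt y + proj (m⁻¹ • v)` (affine contraction), OR every
zoomed point is at minimal-image distance `≥ 1/(4m)` from `x₀`. -/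
theorem zoomPt_local {m : ℝ} (hm : 1 < m) (x₀ y : T3) :
    (∀ v : V3, ‖v‖ < 1 / 8 →
        zoomPt x₀ m (y + Torus.proj v) = zoomPt x₀ m y + Torus.proj (m⁻¹ • v)) ∨
      (∀ v : V3, ‖v‖ < 1 / 8 →
        1 / (4 * m) ≤ Torus.euclidDist (zoomPt x₀ m (y + Torus.proj v)) x₀) := by
  rcases lt_or_ge ‖Torus.reprc (y - x₀)‖ (3 / 8) with h | h
  · exact Or.inl fun v hv => zoomPt_add_proj_of_near x₀ m h hv
  · refine Or.inr fun v hv => ?_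
    have h1 := norm_reprc_ge_of_far x₀ h hv
    rw [euclidDist_zoomPt hm, ← norm_reprc_sub_eq_euclidDist, one_div, mul_inv, ← one_div, mul_comm]
    exact mul_le_mul_of_nonneg_left h1 (inv_nonneg.2 (zero_lt_one.trans hm).le)

/-! ## Fields constant outside a small ball: the zoomed field in charts -/

section Calculus

variable {X : Type*} [NormedAddCommGroup X] [NormedSpace ℝ X]
variable {m a : ℝ} {x₀ : T3}

/-- `m a < 1/4` with `m > 0` means `a < 1/(4m)`. -/
theorem lt_one_div_four_mul (hm : 0 < m) (hma : m * a < 1 / 4) : a < 1 / (4 * m) := by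
  rw [lt_div_iff₀ (by positivity)]; linarith

/-- `m a ≤ 1/4` with `m > 0` means `a ≤ 1/(4m)`. -/
theorem le_one_div_four_mul (hm : 0 < m) (hma : m * a ≤ 1 / 4) : a ≤ 1 / (4 * m) := by
  rw [le_div_iff₀ (by positivity)]; linarith

omit [NormedAddCommGroup X] [NormedSpace ℝ X] in
/-- A field constant (`= c`) outside `{d(·, x₀) < a}` is, in the chart at any point `x` with
`a < d(x, x₀)`, eventually constant near `0`. -/
theorem liftAt_eventuallyEq_const {F : T3 → X} {c : X}
    (hF : ∀ x, a ≤ Torus.euclidDist x x₀ → F x = c) {x : T3} (hx : a < Torus.euclidDist x x₀) :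
    Torus.liftAt F x =ᶠ[𝓝 0] fun _ => c := by
  have hball : ball (0 : V3) (Torus.euclidDist x x₀ - a) ∈ 𝓝 (0 : V3) :=
    ball_mem_nhds 0 (by linarith)
  filter_upwards [hball] with v hv
  rw [mem_ball_zero_iff] at hv
  refine hF _ ?_
  have h := Torus.euclidDist_le_euclidDist_translate x x₀ v 0
  rw [Torus.proj_zero, add_zero, sub_zero] at h
  linarith

/-- The coordinate line `t ↦ t eᵢ` passes continuously through `0`. -/
theorem tendsto_smul_single (i : Fin 3) :
    Tendsto (fun t : ℝ => t • EuclideanSpace.single i (1 : ℝ)) (𝓝 0) (𝓝 (0 : V3)) :=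
  (continuous_id.smul continuous_const).tendsto' (0 : ℝ) (0 : V3) (by simp)

/-- Outside a slightly larger ball all partial derivatives of such a field vanish (no regularity
assumed: the coordinate-line restriction is eventually constant). -/
theorem partialDeriv_eq_zero_of_far {F : T3 → X} {c : X}
    (hF : ∀ x, a ≤ Torus.euclidDist x x₀ → F x = c) (i : Fin 3) {x : T3}
    (hx : a < Torus.euclidDist x x₀) : Torus.partialDeriv i F x = 0 := by
  have h' : (fun t : ℝ => Torus.liftAt F x (t • EuclideanSpace.single i (1 : ℝ))) =ᶠ[𝓝 0]
      fun _ => c := (liftAt_eventuallyEq_const hF hx).comp_tendsto (tendsto_smul_single i)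
  change deriv (fun t : ℝ => Torus.liftAt F x (t • EuclideanSpace.single i (1 : ℝ))) 0 = 0
  rw [h'.deriv_eq, deriv_const]

omit [NormedAddCommGroup X] [NormedSpace ℝ X] in
/-- **The zoomed field in charts.** For `F` constant outside `{d(·, x₀) < a}`, `m > 1`, `m a < 1/4`
and every `y`: EITHER the chart of `F ∘ zoomPt x₀ m` at `y` is eventually the chart of `F` at
`zoomPt x₀ m y` precomposed with `v ↦ m⁻¹ • v`, OR both charts are eventually constant. -/
theorem liftAt_zoom_local (hm : 1 < m) (hma : m * a < 1 / 4) {F : T3 → X} {c : X}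
    (hF : ∀ x, a ≤ Torus.euclidDist x x₀ → F x = c) (y : T3) :
    (Torus.liftAt (fun y => F (zoomPt x₀ m y)) y =ᶠ[𝓝 0]
        fun v => Torus.liftAt F (zoomPt x₀ m y) (m⁻¹ • v)) ∨
      (Torus.liftAt (fun y => F (zoomPt x₀ m y)) y =ᶠ[𝓝 0] (fun _ => c) ∧
        Torus.liftAt F (zoomPt x₀ m y) =ᶠ[𝓝 0] fun _ => c) := by
  have h0 : 0 < m := zero_lt_one.trans hm
  have ha : a < 1 / (4 * m) := lt_one_div_four_mul h0 hma
  have hball : ball (0 : V3) (1 / 8) ∈ 𝓝 (0 : V3) := ball_mem_nhds 0 (by norm_num)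
  rcases zoomPt_local hm x₀ y with h | h
  · refine Or.inl ?_
    filter_upwards [hball] with v hv
    rw [mem_ball_zero_iff] at hv
    simp only [Torus.liftAt_apply]
    rw [h v hv]
  · refine Or.inr ⟨?_, ?_⟩
    · filter_upwards [hball] with v hv
      rw [mem_ball_zero_iff] at hv
      exact hF _ (ha.le.trans (h v hv))
    · refine liftAt_eventuallyEq_const hF (ha.trans_le ?_)
      have := h 0 (by rw [norm_zero]; norm_num)
      rwa [Torus.proj_zero, add_zero] at this

/-- **(Z2) Partial derivatives of the zoomed field**, junk values included:
`∂ᵢ(F ∘ zoomPt x₀ m)(y) = m⁻¹ • (∂ᵢF)(zoomPt x₀ m y)`. -/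
theorem partialDeriv_zoom (hm : 1 < m) (hma : m * a < 1 / 4) {F : T3 → X} {c : X}
    (hF : ∀ x, a ≤ Torus.euclidDist x x₀ → F x = c) (i : Fin 3) (y : T3) :
    Torus.partialDeriv i (fun y => F (zoomPt x₀ m y)) y =
      m⁻¹ • Torus.partialDeriv i F (zoomPt x₀ m y) := by
  have ht := tendsto_smul_single i
  change deriv (fun t : ℝ => Torus.liftAt (fun y => F (zoomPt x₀ m y)) y
      (t • EuclideanSpace.single i (1 : ℝ))) 0 =
    m⁻¹ • deriv (fun t : ℝ => Torus.liftAt F (zoomPt x₀ m y) (t • EuclideanSpace.single i (1 : ℝ))) 0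
  rcases liftAt_zoom_local hm hma hF y with h | ⟨h1, h2⟩
  · have h' : (fun t : ℝ => Torus.liftAt (fun y => F (zoomPt x₀ m y)) y
          (t • EuclideanSpace.single i (1 : ℝ))) =ᶠ[𝓝 0]
        fun t : ℝ => (fun s : ℝ => Torus.liftAt F (zoomPt x₀ m y)
          (s • EuclideanSpace.single i (1 : ℝ))) (m⁻¹ * t) := by
      refine (h.comp_tendsto ht).trans (Eventually.of_forall fun t => ?_)
      simp only [Function.comp_apply, smul_smul]
    rw [h'.deriv_eq, deriv_comp_mul_left m⁻¹ (fun s : ℝ => Torus.liftAt F (zoomPt x₀ m y)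
      (s • EuclideanSpace.single i (1 : ℝ))) 0, mul_zero]
  · have h1' : (fun t : ℝ => Torus.liftAt (fun y => F (zoomPt x₀ m y)) y
          (t • EuclideanSpace.single i (1 : ℝ))) =ᶠ[𝓝 0] fun _ => c := h1.comp_tendsto ht
    have h2' : (fun t : ℝ => Torus.liftAt F (zoomPt x₀ m y)
          (t • EuclideanSpace.single i (1 : ℝ))) =ᶠ[𝓝 0] fun _ => c := h2.comp_tendsto ht
    rw [h1'.deriv_eq, h2'.deriv_eq, deriv_const, smul_zero]

/-- The same as an identity of functions. -/
theorem partialDeriv_zoom' (hm : 1 < m) (hma : m * a < 1 / 4) {F : T3 → X} {c : X}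
    (hF : ∀ x, a ≤ Torus.euclidDist x x₀ → F x = c) (i : Fin 3) :
    Torus.partialDeriv i (fun y => F (zoomPt x₀ m y)) =
      fun y => m⁻¹ • Torus.partialDeriv i F (zoomPt x₀ m y) :=
  funext fun y => partialDeriv_zoom hm hma hF i y

/-- Scalar version of `partialDeriv_zoom`. -/
theorem partialDeriv_zoom_mul (hm : 1 < m) (hma : m * a < 1 / 4) {F : T3 → ℝ} {c : ℝ}
    (hF : ∀ x, a ≤ Torus.euclidDist x x₀ → F x = c) (i : Fin 3) (y : T3) :
    Torus.partialDeriv i (fun y => F (zoomPt x₀ m y)) y =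
      m⁻¹ * Torus.partialDeriv i F (zoomPt x₀ m y) := by
  rw [partialDeriv_zoom hm hma hF i y, smul_eq_mul]

/-! ## Joint space–time smoothness of zoomed fields -/

/-- **(Z1, smoothness) Joint smoothness is preserved by the zoom** (`m > 1`, `m a ≤ 1/4`): for `φ`
jointly smooth on `S × 𝕋³` with slices constant outside `{d(·, x₀) < a}`, `(t, y) ↦ φ t (zoomPt x₀ m y)`
is jointly smooth on `S × 𝕋³` (its lift is locally `stLift φ ∘ affine` or constant). -/
theorem isSmoothSpaceTimeOn_zoom {S : Set ℝ} {φ : ℝ → T3 → X} {c : X}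
    (hφ : Torus.IsSmoothSpaceTimeOn S φ) (hm : 1 < m) (hma : m * a ≤ 1 / 4)
    (hsupp : ∀ t ∈ S, ∀ x, a ≤ Torus.euclidDist x x₀ → φ t x = c) :
    Torus.IsSmoothSpaceTimeOn S (fun t y => φ t (zoomPt x₀ m y)) := by
  have h0 : 0 < m := zero_lt_one.trans hm
  have ha : a ≤ 1 / (4 * m) := le_one_div_four_mul h0 hma
  rintro ⟨t₀, w₀⟩ hp
  have hnhds : {q : ℝ × V3 | ‖q.2 - w₀‖ < 1 / 8} ∈ 𝓝 (t₀, w₀) := by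
    have hc : Continuous fun q : ℝ × V3 => ‖q.2 - w₀‖ := by fun_prop
    exact (hc.isOpen_preimage _ isOpen_Iio).mem_nhds (by simp)
  have hpr : ∀ w : V3, Torus.proj w = Torus.proj w₀ + Torus.proj (w - w₀) := fun w => by
    rw [← Torus.proj_add, add_sub_cancel]
  rcases zoomPt_local hm x₀ (Torus.proj w₀) with h | h
  · set z := Torus.reprc (zoomPt x₀ m (Torus.proj w₀)) with hz
    have hA : ContDiff ℝ ∞ (fun q : ℝ × V3 => (q.1, z + m⁻¹ • (q.2 - w₀))) := by fun_prop
    have hcomp : ContDiffOn ℝ ∞ (Torus.stLift φ ∘ fun q : ℝ × V3 => (q.1, z + m⁻¹ • (q.2 - w₀)))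
        (S ×ˢ univ) :=
      hφ.comp hA.contDiffOn fun q hq => mk_mem_prod (mem_prod.1 hq).1 (mem_univ _)
    have heq : Torus.stLift (fun t y => φ t (zoomPt x₀ m y)) =ᶠ[𝓝 (t₀, w₀)]
        (Torus.stLift φ ∘ fun q : ℝ × V3 => (q.1, z + m⁻¹ • (q.2 - w₀))) := by
      filter_upwards [hnhds] with q hq
      simp only [Function.comp_apply, Torus.stLift]
      rw [hpr q.2, h _ hq, Torus.proj_add, hz, Torus.proj_reprc]
    exact (hcomp _ hp).congr_of_eventuallyEq (heq.filter_mono nhdsWithin_le_nhds) heq.eq_of_nhds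
  · have heq : Torus.stLift (fun t y => φ t (zoomPt x₀ m y)) =ᶠ[𝓝[S ×ˢ univ] (t₀, w₀)]
        fun _ => c := by
      filter_upwards [mem_nhdsWithin_of_mem_nhds hnhds, self_mem_nhdsWithin] with q hq hqS
      simp only [Torus.stLift]
      rw [hpr q.2]
      exact hsupp q.1 (mem_prod.1 hqS).1 _ (ha.trans (h _ hq))
    exact contDiffWithinAt_const.congr_of_eventuallyEq heq (heq.self_of_nhdsWithin hp)

/-- In particular the zoom of a smooth field constant outside `{d(·, x₀) < a}` is smooth. -/
theorem isSmooth_zoom {F : T3 → X} {c : X} (hF : Torus.IsSmooth F) (hm : 1 < m)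
    (hma : m * a ≤ 1 / 4) (hsupp : ∀ x, a ≤ Torus.euclidDist x x₀ → F x = c) :
    Torus.IsSmooth (fun y => F (zoomPt x₀ m y)) :=
  (isSmoothSpaceTimeOn_zoom (Torus.isSmoothSpaceTimeOn_const hF univ) hm hma
    fun _ _ => hsupp).isSmooth_slice (mem_univ 0)

/-- **The zoom dictionary (Z2), packaged** (registered helper of `stub_bubble`): for `m > 1`,
`m a < 1/4` and any field `F` on `𝕋³` equal to `c` outside `{d(·, x₀) < a}` — smoothness is
preserved, `∂ᵢ(F ∘ zoomPt x₀ m) = m⁻¹ • (∂ᵢF) ∘ zoomPt x₀ m` (junk included), the zoomed field is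
`c` outside `{d(·, x₀) < m a}`, and `∂ᵢF = 0` outside every larger ball (to iterate). -/
theorem zoom_calculus : ∀ {X : Type*} [NormedAddCommGroup X] [NormedSpace ℝ X] {m a : ℝ}
    {x₀ : T3} {F : T3 → X} {c : X}, 1 < m → m * a < 1 / 4 →
    (∀ x, a ≤ Torus.euclidDist x x₀ → F x = c) →
    (Torus.IsSmooth F → Torus.IsSmooth (fun y => F (zoomPt x₀ m y))) ∧
    (∀ (i : Fin 3) (y : T3), Torus.partialDeriv i (fun y => F (zoomPt x₀ m y)) y =
      m⁻¹ • Torus.partialDeriv i F (zoomPt x₀ m y)) ∧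
    (∀ y : T3, m * a ≤ Torus.euclidDist y x₀ → F (zoomPt x₀ m y) = c) ∧
    (∀ (i : Fin 3) (x : T3), a < Torus.euclidDist x x₀ → Torus.partialDeriv i F x = 0) :=
  fun hm hma hF => ⟨fun hs => isSmooth_zoom hs hm hma.le hF, partialDeriv_zoom hm hma hF,
    fun _ hy => zoom_eq_of_le hm hF hy, fun i _ hx => partialDeriv_eq_zero_of_far hF i hx⟩

end Calculus

end Summit.AtomisticToContinuum.HydrodynamicLimit.Theorems.ConeLocalisation.Bubble

end
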